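import Literature.Geometry.Riemannian.HarmonicOneFormBochner
import Literature.Geometry.Lorentzian.MetricNormSqBounds
import Literature.Geometry.Lorentzian.CurvatureRegularity
import HarnessLib

/-!
# `1`-forms in a chart: coefficient functions, their derivatives, and pointwise comparison with
# the metric quantities `|α|²_h`, `|∇α|²_h`

Support file (all results proved) for the compactness step of the proof programme of
`Literature.Geometry.Riemannian.Carron1999_finrank_l2HarmonicOneForms_le` (Carron's memoir,
Thm. 4.3: finiteness of `ℋ¹`): to run a Rellich–Kondrachov argument on the coefficient functions
`α̂ᵢ = α(∂ᵢ) ∘ φ⁻¹` of `1`-forms `α` in a chart `φ`, one needs the classical facts that, on a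
coordinate patch, the Euclidean size of the coefficients and of their partial derivatives is
controlled by `|α|²_h = h⁻¹(α, α)` and `|∇α|²_h`, and conversely (O'Neill 1983, Ch. 3, p. 60:
`g⁻¹ = (gⁱʲ)`; Def. 3.16–3.17: `(∇_{∂ₖ} α)(∂ᵢ) = ∂ₖ(α(∂ᵢ)) - α(∇_{∂ₖ} ∂ᵢ)`). For a smooth
pseudo-Riemannian metric `g` (Riemannian where stated) on a manifold with boundaryless model,
coordinate frame `∂ᵢ = (trivializationAt …).localFrame b i` of the chart at `x₀`:

* `contMDiffAt_oneForm_apply_localFrame` — `p ↦ α_p(∂ᵢ|_p)` is `C^∞` on the chart domain for a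
  `C^∞` form `α`;
* `fderiv_oneForm_rep_localFrame` — **`∂ₖ α̂ᵢ = (∇α)(∂ᵢ, ∂ₖ) + α(∇_{∂ₖ} ∂ᵢ)`** at `φ p`;
* `abs_oneForm_apply_le` — Cauchy–Schwarz `|α(v)| ≤ |α|_h |v|_h`;
* `sum_sq_oneForm_apply_localFrame_le` — `∑ᵢ α(∂ᵢ)² ≤ (∑ᵢ h(∂ᵢ, ∂ᵢ)) |α|²_h`;
* `innerDual_le_mul_sum_sq` — `|α|²_h ≤ (#ι) Γ ∑ᵢ α(∂ᵢ)²` whenever `|hⁱʲ(p)| ≤ Γ`;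
* `sq_fderiv_oneForm_rep_le` — `(∂ₖ α̂ᵢ)² ≤ 2 |∇α|²_h h(∂ᵢ,∂ᵢ) h(∂ₖ,∂ₖ) + 2 |α|²_h |∇_{∂ₖ}∂ᵢ|²_h`;
* continuity of the chart data `g(∂ᵢ,∂ⱼ)`, `gⁱʲ`, `∇_{∂ₖ}∂ᵢ` on the chart domain
  (`continuousOn_gram_localFrame_chart`, `continuousOn_gramInv_localFrame_chart`,
  `contMDiffOn_leviCivita_localFrame`, `continuousOn_val_leviCivita_localFrame`) and the uniform
  bounds on compact subsets (`exists_chart_data_bound`).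

Everything is proved; no definitions, no named facts (D-0026).

## References

* B. O'Neill, *Semi-Riemannian geometry*, Academic Press 1983, Ch. 3, p. 60 (`gⁱʲ`, metrically
  equivalent covectors), Def. 3.16–3.17 (covariant derivative of one-forms), Prop. 3.13
  (Christoffel symbols). [`ONeill1983`]
-/

noncomputable section

open Bundle Set Function Filter FiberBundle VectorField Finset
open scoped Manifold ContDiff Topology Matrix

namespace Literature.Geometry.Riemannian

open Literature.Geometry.Lorentzian

variable {E : Type*} [NormedAddCommGroup E] [NormedSpace ℝ E] {H : Type*} [TopologicalSpace H]
  {I : ModelWithCorners ℝ E H} {M : Type*} [TopologicalSpace M] [ChartedSpace H M]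
  [IsManifold I ∞ M] [FiniteDimensional ℝ E]
  (g : PseudoRiemannianMetric I ∞ E (TangentSpace I : M → Type _))
  {ι : Type*} (b : Module.Basis ι ℝ E) {x₀ p : M}

/-! ### Smoothness of the coefficient functions `p ↦ α_p(∂ᵢ)` -/

omit [FiniteDimensional ℝ E] in
/-- A `C^∞` `1`-form evaluated on a `C^∞` vector field is a `C^∞` function (Mathlib's
`ContMDiffAt.clm_bundle_apply` with values in the trivial bundle). O'Neill 1983, Ch. 2, p. 42
(tensor fields as `𝔉(M)`-multilinear maps). [folklore] -/
theorem contMDiffAt_oneForm_apply {α : Π x : M, TangentSpace I x →L[ℝ] ℝ}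
    (hα : ContMDiffAt I (I.prod 𝓘(ℝ, E →L[ℝ] ℝ)) ∞ (oneFormSection α) p)
    {Y : Π x : M, TangentSpace I x} (hY : CMDiffAt ∞ (T% Y) p) :
    ContMDiffAt I 𝓘(ℝ, ℝ) ∞ (fun y ↦ α y (Y y)) p := by
  have : ContMDiffAt I (I.prod 𝓘(ℝ, ℝ)) ∞
      (fun y ↦ TotalSpace.mk' ℝ (E := Bundle.Trivial M ℝ) y (α y (Y y))) p := by
    apply ContMDiffAt.clm_bundle_apply (F₁ := E)
    · exact hα
    · exact hY
  simp only [contMDiffAt_totalSpace] at this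
  exact this.2

omit [FiniteDimensional ℝ E] in
/-- **The coefficient functions of a smooth `1`-form are smooth**: `p ↦ α_p(∂ᵢ|_p)` is `C^∞` at
every point of the chart domain of `x₀` (`∂ᵢ` the coordinate frame, smooth there). [folklore] -/
theorem contMDiffAt_oneForm_apply_localFrame (hp : p ∈ (chartAt H x₀).source)
    {α : Π x : M, TangentSpace I x →L[ℝ] ℝ}
    (hα : ContMDiffAt I (I.prod 𝓘(ℝ, E →L[ℝ] ℝ)) ∞ (oneFormSection α) p) (i : ι) :
    ContMDiffAt I 𝓘(ℝ, ℝ) ∞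
      (fun y ↦ α y ((trivializationAt E (TangentSpace I) x₀).localFrame b i y)) p :=
  contMDiffAt_oneForm_apply hα (contMDiffAt_localFrame_chart b hp i)

/-! ### `∂ₖ α̂ᵢ = (∇α)(∂ᵢ, ∂ₖ) + α(∇_{∂ₖ} ∂ᵢ)` -/

variable [I.Boundaryless] [g.HasLeviCivita]

/-- **Partial derivatives of the coefficient functions of a `1`-form.** For `α` differentiable at
a point `p` of the chart domain of `x₀`, coordinate frame `∂ᵢ` and chart `φ`:
`∂ₖ (α(∂ᵢ) ∘ φ⁻¹)(φ p) = (∇α)_p(∂ᵢ, ∂ₖ) + α_p(∇_{∂ₖ} ∂ᵢ)`, i.e. the defining formula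
`(∇_{∂ₖ} α)(∂ᵢ) = ∂ₖ(α(∂ᵢ)) - α(∇_{∂ₖ} ∂ᵢ)` of the covariant derivative of one-forms solved for
the partial derivative. O'Neill 1983, Ch. 3, Def. 3.16–3.17. [cite: ONeill1983, Ch. 3, Def. 3.16–3.17] -/
theorem fderiv_oneForm_rep_localFrame (hp : p ∈ (chartAt H x₀).source)
    {α : Π x : M, TangentSpace I x →L[ℝ] ℝ}
    (hα : MDifferentiableAt I (I.prod 𝓘(ℝ, E →L[ℝ] ℝ)) (oneFormSection α) p) (i k : ι) :
    fderiv ℝ ((fun q ↦ α q ((trivializationAt E (TangentSpace I) x₀).localFrame b i q)) ∘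
        (extChartAt I x₀).symm) (extChartAt I x₀ p) (b k) =
      g.covDerivOneForm α p ((trivializationAt E (TangentSpace I) x₀).localFrame b i p)
          ((trivializationAt E (TangentSpace I) x₀).localFrame b k p) +
        α p (g.leviCivita ((trivializationAt E (TangentSpace I) x₀).localFrame b i) p
          ((trivializationAt E (TangentSpace I) x₀).localFrame b k p)) := by
  set e := trivializationAt E (TangentSpace I) x₀
  have hpe : p ∈ e.baseSet := by simpa [e] using hp
  have hs : ∀ j, MDiffAt (T% (e.localFrame b j)) p := fun j ↦
    (contMDiffAt_localFrame_of_mem 1 e b j hpe).mdifferentiableAt one_ne_zero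
  rw [covDerivOneForm_apply (g := g) hα (hs i) (e.localFrame b k)]
  simp only [PseudoRiemannianMetric.covDerivOneFormAux]
  rw [mvfderiv_apply_localFrame b hp (mdifferentiableAt_oneForm_apply hα (hs i)) k]
  ring

/-! ### Pointwise comparison with the metric quantities -/

omit [I.Boundaryless] [g.HasLeviCivita] in
/-- **Cauchy–Schwarz for a covector and a vector**: `|α(v)| ≤ |α|_g |v|_g` for a Riemannian `g`
(`α(v) = g(♯α, v)`, `|♯α|² = g⁻¹(α, α)`). [folklore] -/
theorem abs_oneForm_apply_le (hg : g.IsRiemannian) (x : M) (α : Module.Dual ℝ (TangentSpace I x))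
    (v : TangentSpace I x) :
    |α v| ≤ Real.sqrt (g.innerDual x α α) * Real.sqrt (g.val x v v) := by
  letI := g.riemannianBundle hg
  have h1 : α v = g.val x (g.sharp x α) v := by rw [PseudoRiemannianMetric.val_sharp_apply]
  have h2 : g.innerDual x α α = g.val x (g.sharp x α) (g.sharp x α) :=
    g.innerDual_eq_val_sharp_sharp x α α
  rw [h1, h2, ← g.inner_eq hg, ← g.inner_eq hg, ← g.inner_eq hg, real_inner_self_eq_norm_sq,
    real_inner_self_eq_norm_sq, Real.sqrt_sq (norm_nonneg _), Real.sqrt_sq (norm_nonneg _)]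
  exact abs_real_inner_le_norm _ _

omit [I.Boundaryless] [g.HasLeviCivita] in
/-- `α(v)² ≤ g⁻¹(α, α) g(v, v)` for a Riemannian `g`. [folklore] -/
theorem sq_oneForm_apply_le (hg : g.IsRiemannian) (x : M) (α : Module.Dual ℝ (TangentSpace I x))
    (v : TangentSpace I x) :
    (α v) ^ 2 ≤ g.innerDual x α α * g.val x v v := by
  have h := abs_oneForm_apply_le g hg x α v
  have hA : 0 ≤ g.innerDual x α α := by
    rw [g.innerDual_eq_val_sharp_sharp]
    by_cases h0 : g.sharp x α = 0
    · rw [h0]; simp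
    · exact (hg x _ h0).le
  have hV : 0 ≤ g.val x v v := by
    by_cases h0 : v = 0
    · rw [h0]; simp
    · exact (hg x v h0).le
  calc (α v) ^ 2 = |α v| ^ 2 := (sq_abs _).symm
    _ ≤ (Real.sqrt (g.innerDual x α α) * Real.sqrt (g.val x v v)) ^ 2 :=
        pow_le_pow_left₀ (abs_nonneg _) h 2
    _ = g.innerDual x α α * g.val x v v := by
        rw [mul_pow, Real.sq_sqrt hA, Real.sq_sqrt hV]

/-- **Partial derivatives of the coefficients are controlled by `|∇α|_g` and `|α|_g`.** For a
Riemannian `g`, `α` differentiable at a point `p` of the chart domain of `x₀`, coordinate frame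
`∂ᵢ`: `(∂ₖ α̂ᵢ(φ p))² ≤ 2 |∇α|²_g g(∂ᵢ,∂ᵢ) g(∂ₖ,∂ₖ) + 2 g⁻¹(α,α) g(∇_{∂ₖ}∂ᵢ, ∇_{∂ₖ}∂ᵢ)`
(`fderiv_oneForm_rep_localFrame`, Cauchy–Schwarz for `normSq` and for `g⁻¹`). [folklore] -/
theorem sq_fderiv_oneForm_rep_le (hg : g.IsRiemannian) (hp : p ∈ (chartAt H x₀).source)
    {α : Π x : M, TangentSpace I x →L[ℝ] ℝ}
    (hα : MDifferentiableAt I (I.prod 𝓘(ℝ, E →L[ℝ] ℝ)) (oneFormSection α) p) (i k : ι) :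
    (fderiv ℝ ((fun q ↦ α q ((trivializationAt E (TangentSpace I) x₀).localFrame b i q)) ∘
        (extChartAt I x₀).symm) (extChartAt I x₀ p) (b k)) ^ 2 ≤
      2 * (g.normSq p (g.covDerivOneForm α p) *
          g.val p ((trivializationAt E (TangentSpace I) x₀).localFrame b i p)
            ((trivializationAt E (TangentSpace I) x₀).localFrame b i p) *
          g.val p ((trivializationAt E (TangentSpace I) x₀).localFrame b k p)
            ((trivializationAt E (TangentSpace I) x₀).localFrame b k p)) +
        2 * (g.innerDual p (α p : TangentSpace I p →ₗ[ℝ] ℝ) (α p) *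
          g.val p (g.leviCivita ((trivializationAt E (TangentSpace I) x₀).localFrame b i) p
              ((trivializationAt E (TangentSpace I) x₀).localFrame b k p))
            (g.leviCivita ((trivializationAt E (TangentSpace I) x₀).localFrame b i) p
              ((trivializationAt E (TangentSpace I) x₀).localFrame b k p))) := by
  rw [fderiv_oneForm_rep_localFrame g b hp hα i k]
  set T := g.covDerivOneForm α p
  set si := (trivializationAt E (TangentSpace I) x₀).localFrame b i p
  set sk := (trivializationAt E (TangentSpace I) x₀).localFrame b k p
  set W := g.leviCivita ((trivializationAt E (TangentSpace I) x₀).localFrame b i) p sk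
  have h1 : (T si sk) ^ 2 ≤ g.normSq p T * g.val p si si * g.val p sk sk :=
    g.sq_apply_le_normSq_mul p hg T si sk
  have h2 : (α p W) ^ 2 ≤ g.innerDual p (α p : TangentSpace I p →ₗ[ℝ] ℝ) (α p) * g.val p W W := by
    have := sq_oneForm_apply_le g hg p (α p : TangentSpace I p →ₗ[ℝ] ℝ) W
    simpa using this
  nlinarith [h1, h2, sq_nonneg (T si sk - α p W)]


variable [Fintype ι]

omit [I.Boundaryless] [g.HasLeviCivita] in
/-- **Coefficients are controlled by the metric norm**: for a Riemannian `g` and any finite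
family of tangent vectors `sᵢ` at `x` (e.g. a coordinate frame),
`∑ᵢ α(sᵢ)² ≤ (∑ᵢ g(sᵢ, sᵢ)) g⁻¹(α, α)`. [folklore] -/
theorem sum_sq_oneForm_apply_le (hg : g.IsRiemannian) (x : M) (α : Module.Dual ℝ (TangentSpace I x))
    (s : ι → TangentSpace I x) :
    ∑ i, (α (s i)) ^ 2 ≤ (∑ i, g.val x (s i) (s i)) * g.innerDual x α α := by
  rw [Finset.sum_mul]
  exact Finset.sum_le_sum fun i _ ↦ by
    rw [mul_comm]; exact sq_oneForm_apply_le g hg x α (s i)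

variable [DecidableEq ι]

omit [I.Boundaryless] [g.HasLeviCivita] in
/-- **The metric norm is controlled by the coefficients**: at a point `p` of the chart domain of
`x₀`, if all entries of the inverse Gram matrix `(gⁱʲ(p))` of the coordinate frame are bounded by
`Γ` in absolute value, then `g⁻¹_p(α, α) ≤ (#ι) Γ ∑ᵢ α(∂ᵢ)²` (`innerDual_eq_sum_localFrame` and
`(∑ |aᵢ|)² ≤ #ι ∑ aᵢ²`). [folklore] -/
theorem innerDual_le_mul_sum_sq (hp : p ∈ (chartAt H x₀).source)
    (α : Module.Dual ℝ (TangentSpace I p)) {Γ : ℝ}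
    (hΓ : ∀ k l, |(Matrix.of fun i j ↦ g.val p
        ((trivializationAt E (TangentSpace I) x₀).localFrame b i p)
        ((trivializationAt E (TangentSpace I) x₀).localFrame b j p))⁻¹ k l| ≤ Γ) :
    g.innerDual p α α ≤ (Fintype.card ι) * Γ *
      ∑ i, (α ((trivializationAt E (TangentSpace I) x₀).localFrame b i p)) ^ 2 := by
  set a : ι → ℝ := fun i ↦ α ((trivializationAt E (TangentSpace I) x₀).localFrame b i p) with ha
  rcases isEmpty_or_nonempty ι with hι | ⟨⟨i₀⟩⟩
  · simp [innerDual_eq_sum_localFrame g b hp α α]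
  have hΓ0 : 0 ≤ Γ := (abs_nonneg _).trans (hΓ i₀ i₀)
  rw [innerDual_eq_sum_localFrame g b hp α α]
  calc ∑ l, ∑ k, (Matrix.of fun i j ↦ g.val p
          ((trivializationAt E (TangentSpace I) x₀).localFrame b i p)
          ((trivializationAt E (TangentSpace I) x₀).localFrame b j p))⁻¹ k l * a k * a l
      ≤ ∑ l, ∑ k, Γ * |a k| * |a l| := by
        refine Finset.sum_le_sum fun l _ ↦ Finset.sum_le_sum fun k _ ↦ ?_
        calc _ ≤ |(Matrix.of fun i j ↦ g.val p
              ((trivializationAt E (TangentSpace I) x₀).localFrame b i p)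
              ((trivializationAt E (TangentSpace I) x₀).localFrame b j p))⁻¹ k l * a k * a l| :=
              le_abs_self _
          _ = |(Matrix.of fun i j ↦ g.val p
              ((trivializationAt E (TangentSpace I) x₀).localFrame b i p)
              ((trivializationAt E (TangentSpace I) x₀).localFrame b j p))⁻¹ k l| * |a k| * |a l| := by
              rw [abs_mul, abs_mul]
          _ ≤ Γ * |a k| * |a l| := by
              gcongr
              exact hΓ k l
    _ = Γ * (∑ i, |a i|) ^ 2 := by
        rw [sq, Finset.sum_mul_sum, Finset.mul_sum, Finset.sum_comm]
        refine Finset.sum_congr rfl fun l _ ↦ ?_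
        rw [Finset.mul_sum]
        refine Finset.sum_congr rfl fun k _ ↦ ?_
        ring
    _ ≤ Γ * ((Fintype.card ι) * ∑ i, |a i| ^ 2) := by
        refine mul_le_mul_of_nonneg_left ?_ hΓ0
        have := sq_sum_le_card_mul_sum_sq (s := Finset.univ) (f := fun i ↦ |a i|)
        simpa using this
    _ = (Fintype.card ι) * Γ * ∑ i, (a i) ^ 2 := by
        simp only [sq_abs]; ring

/-! ### Continuity of the chart data on the chart domain, and bounds on compact subsets -/

omit [FiniteDimensional ℝ E] [I.Boundaryless] [g.HasLeviCivita] [DecidableEq ι] [Fintype ι] in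
/-- The Gram matrix entries `p ↦ g(∂ᵢ, ∂ⱼ)(p)` of the coordinate frame are continuous on the
chart domain (`contMDiffOn_gram_localFrame`). [folklore] -/
theorem continuousOn_gram_localFrame_chart (i j : ι) :
    ContinuousOn (fun p ↦ g.val p ((trivializationAt E (TangentSpace I) x₀).localFrame b i p)
      ((trivializationAt E (TangentSpace I) x₀).localFrame b j p)) (chartAt H x₀).source := by
  have hbase : (trivializationAt E (TangentSpace I) x₀).baseSet = (chartAt H x₀).source := by simp
  rw [← hbase]
  exact (contMDiffOn_gram_localFrame (trivializationAt E (TangentSpace I) x₀) g b i j).continuousOn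

omit [FiniteDimensional ℝ E] [I.Boundaryless] [g.HasLeviCivita] in
/-- The inverse Gram matrix entries `p ↦ gⁱʲ(p)` of the coordinate frame are continuous on the
chart domain (`contMDiffOn_gram_localFrame_inv`). [folklore] -/
theorem continuousOn_gramInv_localFrame_chart (k l : ι) :
    ContinuousOn (fun p ↦ (Matrix.of fun i j ↦ g.val p
        ((trivializationAt E (TangentSpace I) x₀).localFrame b i p)
        ((trivializationAt E (TangentSpace I) x₀).localFrame b j p))⁻¹ k l)
      (chartAt H x₀).source := by
  have hbase : (trivializationAt E (TangentSpace I) x₀).baseSet = (chartAt H x₀).source := by simp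
  rw [← hbase]
  exact (contMDiffOn_gram_localFrame_inv (trivializationAt E (TangentSpace I) x₀) g b k l).continuousOn

omit [I.Boundaryless] [DecidableEq ι] [Fintype ι] in
/-- **The connection applied to the coordinate frame is a `C¹` field on the chart domain**:
`p ↦ ∇_{∂ₖ} ∂ᵢ (p)` (the Levi-Civita connection of a smooth metric is locally `C¹`,
`isLocallyContMDiff_leviCivita_holds`; O'Neill 1983, Ch. 3, Prop. 3.13: `D_{∂ᵢ}∂ⱼ = ∑ Γᵏᵢⱼ ∂ₖ` with
smooth `Γ`). [cite: ONeill1983, Ch. 3, Prop. 3.13] -/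
theorem contMDiffOn_leviCivita_localFrame (i k : ι) :
    CMDiff[(chartAt H x₀).source] 1 (T% (fun y ↦
      g.leviCivita ((trivializationAt E (TangentSpace I) x₀).localFrame b i) y
        ((trivializationAt E (TangentSpace I) x₀).localFrame b k y))) := by
  set e := trivializationAt E (TangentSpace I : M → Type _) x₀ with he
  have hu : IsOpen (chartAt H x₀).source := (chartAt H x₀).open_source
  have hbase : e.baseSet = (chartAt H x₀).source := by simp [he]
  have hs : ∀ j, CMDiff[(chartAt H x₀).source] ∞ (T% (e.localFrame b j)) := fun j ↦ by
    rw [← hbase]; exact e.contMDiffOn_localFrame_baseSet ∞ b j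
  have hcov := g.isLocallyContMDiff_leviCivita_holds 1
    (by rw [show ((1 : ℕ∞) : ℕ∞ω) + 1 = 2 by norm_num]; exact WithTop.coe_le_coe.2 le_top) _ hu
  have h1 := hcov.contMDiff ((hs i).of_le (by exact_mod_cast le_top))
  exact h1.clm_bundle_apply ((hs k).of_le (by exact_mod_cast le_top))

omit [I.Boundaryless] [DecidableEq ι] [Fintype ι] in
/-- `p ↦ g(∇_{∂ₖ}∂ᵢ, ∇_{∂ₖ}∂ᵢ)(p)` is continuous on the chart domain. [folklore] -/
theorem continuousOn_val_leviCivita_localFrame (i k : ι) :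
    ContinuousOn (fun p ↦ g.val p
      (g.leviCivita ((trivializationAt E (TangentSpace I) x₀).localFrame b i) p
        ((trivializationAt E (TangentSpace I) x₀).localFrame b k p))
      (g.leviCivita ((trivializationAt E (TangentSpace I) x₀).localFrame b i) p
        ((trivializationAt E (TangentSpace I) x₀).localFrame b k p))) (chartAt H x₀).source := by
  intro p hp
  have hW := (contMDiffOn_leviCivita_localFrame g b (x₀ := x₀) i k p hp).contMDiffAt
    ((chartAt H x₀).open_source.mem_nhds hp)
  exact (g.contMDiffAt_val_apply (by exact_mod_cast le_top) hW hW).continuousAt.continuousWithinAt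

omit [I.Boundaryless] in
/-- **Uniform bounds for the chart data on a compact subset of the chart domain**: for a compact
`C ⊆ (chartAt H x₀).source` there is `Λ ≥ 0` bounding `∑ᵢ g(∂ᵢ,∂ᵢ)`, all `|gᵏˡ|` and all
`g(∇_{∂ₖ}∂ᵢ, ∇_{∂ₖ}∂ᵢ)` on `C` (continuity on the chart domain). [folklore] -/
theorem exists_chart_data_bound {C : Set M} (hC : IsCompact C) (hCs : C ⊆ (chartAt H x₀).source) :
    ∃ Λ : ℝ, 0 ≤ Λ ∧
      (∀ p ∈ C, ∑ i, g.val p ((trivializationAt E (TangentSpace I) x₀).localFrame b i p)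
        ((trivializationAt E (TangentSpace I) x₀).localFrame b i p) ≤ Λ) ∧
      (∀ p ∈ C, ∀ k l, |(Matrix.of fun i j ↦ g.val p
        ((trivializationAt E (TangentSpace I) x₀).localFrame b i p)
        ((trivializationAt E (TangentSpace I) x₀).localFrame b j p))⁻¹ k l| ≤ Λ) ∧
      (∀ p ∈ C, ∀ i k, g.val p
        (g.leviCivita ((trivializationAt E (TangentSpace I) x₀).localFrame b i) p
          ((trivializationAt E (TangentSpace I) x₀).localFrame b k p))
        (g.leviCivita ((trivializationAt E (TangentSpace I) x₀).localFrame b i) p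
          ((trivializationAt E (TangentSpace I) x₀).localFrame b k p)) ≤ Λ) := by
  -- each of the finitely many continuous functions is bounded on `C`
  have h1 : ∃ B₁, ∀ p ∈ C, ‖∑ i, g.val p ((trivializationAt E (TangentSpace I) x₀).localFrame b i p)
      ((trivializationAt E (TangentSpace I) x₀).localFrame b i p)‖ ≤ B₁ :=
    hC.exists_bound_of_continuousOn
      ((continuousOn_finsetSum _ fun i _ ↦ continuousOn_gram_localFrame_chart g b i i).mono hCs)
  have h2 : ∀ k l, ∃ B₂, ∀ p ∈ C, ‖(Matrix.of fun i j ↦ g.val p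
      ((trivializationAt E (TangentSpace I) x₀).localFrame b i p)
      ((trivializationAt E (TangentSpace I) x₀).localFrame b j p))⁻¹ k l‖ ≤ B₂ := fun k l ↦
    hC.exists_bound_of_continuousOn ((continuousOn_gramInv_localFrame_chart g b k l).mono hCs)
  have h3 : ∀ i k, ∃ B₃, ∀ p ∈ C, ‖g.val p
      (g.leviCivita ((trivializationAt E (TangentSpace I) x₀).localFrame b i) p
        ((trivializationAt E (TangentSpace I) x₀).localFrame b k p))
      (g.leviCivita ((trivializationAt E (TangentSpace I) x₀).localFrame b i) p
        ((trivializationAt E (TangentSpace I) x₀).localFrame b k p))‖ ≤ B₃ := fun i k ↦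
    hC.exists_bound_of_continuousOn ((continuousOn_val_leviCivita_localFrame g b i k).mono hCs)
  obtain ⟨B₁, hB₁⟩ := h1
  choose B₂ hB₂ using h2
  choose B₃ hB₃ using h3
  refine ⟨max (max B₁ 0) (max (∑ k, ∑ l, |B₂ k l|) (∑ i, ∑ k, |B₃ i k|)), ?_, ?_, ?_, ?_⟩
  · exact (le_max_right _ _).trans (le_max_left _ _)
  · intro p hp
    exact ((Real.norm_eq_abs _ ▸ le_abs_self _).trans (hB₁ p hp)).trans
      ((le_max_left _ _).trans (le_max_left _ _))
  · intro p hp k l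
    have h := hB₂ k l p hp
    rw [Real.norm_eq_abs] at h
    refine (h.trans (le_abs_self _)).trans ?_
    refine le_trans ?_ ((le_max_left _ _).trans (le_max_right _ _))
    exact (Finset.single_le_sum (f := fun l ↦ |B₂ k l|) (fun _ _ ↦ abs_nonneg _)
      (Finset.mem_univ l)).trans (Finset.single_le_sum (f := fun k ↦ ∑ l, |B₂ k l|)
      (fun _ _ ↦ Finset.sum_nonneg fun _ _ ↦ abs_nonneg _) (Finset.mem_univ k))
  · intro p hp i k
    have h := hB₃ i k p hp
    rw [Real.norm_eq_abs] at h
    refine ((le_abs_self _).trans (h.trans (le_abs_self _))).trans ?_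
    refine le_trans ?_ ((le_max_right _ _).trans (le_max_right _ _))
    exact (Finset.single_le_sum (f := fun k ↦ |B₃ i k|) (fun _ _ ↦ abs_nonneg _)
      (Finset.mem_univ k)).trans (Finset.single_le_sum (f := fun i ↦ ∑ k, |B₃ i k|)
      (fun _ _ ↦ Finset.sum_nonneg fun _ _ ↦ abs_nonneg _) (Finset.mem_univ i))

end Literature.Geometry.Riemannian

end
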